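import Mathlib

/-!
# Beta/LocalJacobianAlgebra — the two algebraic skeletons behind «level-local Jacobians contribute NOTHING (or
exactly linearly) to the marginal coefficient» (β sub-cell row an2, HOME/BETA/AN2.md v0.3 §8.10 (a), (c) STEP 1, (f))

HONEST FRAMING (cell `pub-balaban`, β sub-cell; HOME/BETA/AN2.md §0, BETA-SPEC §7–§8).  The β sub-cell tries to
discharge the one-loop input of [Balaban1987RG1] Theorem 2 (`FlowStep.BetaPertH`, read in the drift form of
`Beta/Assembly`); doing so would make Bałaban's ultraviolet STABILITY theorem unconditional — it is NOT the continuum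
limit and NOT the Clay problem, and this module is far less: two pieces of finite-dimensional algebra, `[folklore]`,
that row an2 uses when it distributes the marginal logarithm over the pieces of the gauge-fixed, constrained one-loop
functional (AN2.md §8.6 (S′-exact)).  NOTHING about Bałaban's operators is asserted: that his axial-gauge rows have the
block-triangular shape below, and that the Lie algebra in question is perfect, are statements of the ANALYSIS
(AN2.md §8.10), not of this file.  Value = kernel certificate of two elementary steps, NOT summit progress.

PRINTED CONTEXT (dictionary sentences only; nothing below is used as a hypothesis).
* [Balaban1987RG1] pp. 254–255, (0.13)–(0.16): after the `k`-th step the density is «still invariant with respect to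
  the gauge transformations u satisfying u(y) = 1 for y ∈ T^{(1)}»; p. 254 continues «We have to fix a gauge in order
  to remove this invariance, as in [9, 16], where the block axial gauge was used to this purpose. In order to
  maintain the Euclidean invariance on the lattice T^{(1)} we have to use other expressions than the contour variables
  U(Γ_{y,x}) … Instead we introduce exponential gauge fixing functions» (0.14) in the averaged contour variables
  `U(y,x)` of (0.11) — so in THIS paper the residual gauge is removed NOT by the block axial δ-gauge of [9, 16] but by
  the soft weights (0.14), inserted (p. 255) by «the usual Faddeev-Popov procedure … the integrand does not depend on
  u and the integral over u is equal to 1», the `u`-integral (0.15) being IDENTICALLY 1 by Haar invariance.  Either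
  way NO background-dependent gauge-fixing determinant is created (AN2.md §8.10 (a): `c^{axFP} ≡ 0` printed-exact).
  (Docstring corrected in v1.0.1 on referee remark C-ref5-35 R1; v1 compressed this to «the axial gauge is fixed by
  the FP procedure», which misattributes [9, 16]'s gauge to this paper.  Typed content unchanged.)  The LINEARISED
  shadow of an axial-TYPE complete gauge (a δ-slice along a tree of contours from the block centres, as in [9, 16]
  and in the cell's numerics protocol BETA-SPEC §6.5 (c3); AN2.md §8.10 (f)): the map «residual gauge parameter ↦
  its covariant derivative read along the tree INTO the evaluation points» is, level by level and bond by bond along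
  the tree, TRIANGULAR with diagonal blocks `−Ad(U(Γ))` — orthogonal — hence of `|det| = 1` for EVERY background `U`;
  §1 below is exactly that algebra (`abs_det_eq_one_of_blockTriangular_of_orthogonal`).
* AN2.md §8.10 (c) STEP 1 (criticality of a level-local gauge- and `Ad`-invariant functional at the unit
  configuration): the first variation is an `Ad`-invariant, hence `ad`-invariant, linear functional on the gauge Lie
  algebra, and «an `ad`-invariant linear functional on a PERFECT Lie algebra vanishes» — §2 below
  (`eq_zero_of_forall_lie_of_perfect`); that `su(N)`, `N ≥ 2`, is perfect (indeed simple) and that `Ad`-invariance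
  under a connected group implies `ad`-invariance are NOT formalised here (Mathlib has no `su(N)` simplicity), they
  stay dictionary sentences.

WHAT IS PROVED (all `[folklore]`, over Mathlib only):
* §1 `abs_det_eq_one_of_transpose_mul_self` — a real square matrix `O` with `Oᵀ O = 1` has `|det O| = 1`;
  `abs_det_eq_one_of_blockTriangular_of_orthogonal` — a block-triangular real matrix (Mathlib's
  `Matrix.BlockTriangular b`, any linear order on the block labels) all of whose diagonal blocks `M.toSquareBlock b a`
  satisfy `Oᵀ O = 1` has `|det M| = 1`; hence `Real.log |det M| = 0` (`log_abs_det_eq_zero_of_blockTriangular_of_orthogonal`)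
  — the (c3) constant is `0`, for every background, with no fit.
* §2 `eq_zero_of_forall_lie_of_perfect` — over any commutative ring, a linear functional `f` on a Lie algebra `L` with
  `f ⁅x, y⁆ = 0` for all `x, y` and `⁅⊤, ⊤⁆ = ⊤` (perfectness) is `0`; `apply_eq_zero_of_forall_lie_of_perfect` the
  pointwise form.
* `lie_top_self_eq_top_of_isSimple` / `eq_zero_of_forall_lie_of_isSimple` — a simple Lie algebra (Mathlib's
  `LieAlgebra.IsSimple`) is perfect, so the statement applies to it; non-vacuity `example` for §1: a block-triangular
  `(Fin 2 ⊕ Fin 2)`-matrix with rotation diagonal blocks and an arbitrary off-diagonal block has `|det| = 1`.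
WHAT IS NOT PROVED: that Bałaban's rows are block-triangular with `Ad` diagonal (analysis, AN2.md §8.10 (a2)); that the
gauge algebra is perfect; anything about determinants of NON-local pieces (bulk / unit / ghost log-determinants), any
value or sign of a coefficient, anything about `k → ∞`, `L`, or the infinite volume.

ABSOLUTE RULE.  No internally-minted statement enters as a cited fact: there are no cited facts here at all — every
declaration is proved in this file from Mathlib; the manuscripts' disputed steps are not used.  Companion prose:
HOME/BETA/AN2.md v0.3 §8.10; GAPS rows C-an2-8, C-an2-9.
-/

namespace Literature.MathematicalPhysics.QuantumFieldTheory.Balaban1983to89.Beta.LocalJacobianAlgebra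

open Matrix

/-! ## §1. Block-triangular with orthogonal diagonal blocks ⇒ `|det| = 1` -/

section BlockTriangular

variable {m : Type*} [Fintype m] [DecidableEq m]

/-- A real square matrix with `Oᵀ * O = 1` has `|det O| = 1`. [folklore] -/
theorem abs_det_eq_one_of_transpose_mul_self (O : Matrix m m ℝ) (hO : Oᵀ * O = 1) : |O.det| = 1 := by
  have h : O.det * O.det = 1 := by
    have := congrArg Matrix.det hO
    rwa [det_mul, det_transpose, det_one] at this
  rcases mul_self_eq_one_iff.mp h with h1 | h1 <;> simp [h1]

variable {α : Type*} [LinearOrder α]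

/-- `|det M| = 1` for a block-triangular real matrix all of whose diagonal blocks are orthogonal
(`Oᵀ O = 1`).  This is the algebra of AN2.md §8.10 (a2)/(f): the linearised axial-gauge map of a composed
averaging tower is triangular along the tree with diagonal blocks `−Ad(U(Γ))`. [folklore] -/
theorem abs_det_eq_one_of_blockTriangular_of_orthogonal (M : Matrix m m ℝ) (b : m → α)
    (hM : M.BlockTriangular b)
    (horth : ∀ a : α, (M.toSquareBlock b a)ᵀ * M.toSquareBlock b a = 1) :
    |M.det| = 1 := by
  classical
  rw [hM.det, Finset.abs_prod]
  exact Finset.prod_eq_one fun a _ => abs_det_eq_one_of_transpose_mul_self _ (horth a)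

/-- Hence the logarithm of the Jacobian vanishes identically: the (c3) constant of BETA-SPEC §6.5 is `0` between
axial-type complete slices, for every background. [folklore] -/
theorem log_abs_det_eq_zero_of_blockTriangular_of_orthogonal (M : Matrix m m ℝ) (b : m → α)
    (hM : M.BlockTriangular b)
    (horth : ∀ a : α, (M.toSquareBlock b a)ᵀ * M.toSquareBlock b a = 1) :
    Real.log |M.det| = 0 := by
  rw [abs_det_eq_one_of_blockTriangular_of_orthogonal M b hM horth, Real.log_one]

/-- A product (composition of levels) of such matrices again has `|det| = 1`. [folklore] -/
theorem abs_det_prod_eq_one {ι : Type*} (s : Finset ι) (M : ι → Matrix m m ℝ)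
    (h : ∀ i ∈ s, |(M i).det| = 1) : |(∏ i ∈ s, (M i).det)| = 1 := by
  rw [Finset.abs_prod]
  exact Finset.prod_eq_one h

/-- Non-vacuity: a rotation is orthogonal, and a lower block-triangular `Fin 2 ⊕ Fin 2` matrix with rotation
diagonal blocks and an ARBITRARY off-diagonal block has `|det| = 1`. -/
example (c s t : ℝ) (h : c ^ 2 + s ^ 2 = 1) :
    |(Matrix.fromBlocks !![c, -s; s, c] 0 !![t, t; 0, t] !![c, -s; s, c]).det| = 1 := by
  rw [Matrix.det_fromBlocks_zero₁₂, abs_mul]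
  have hd : (!![c, -s; s, c] : Matrix (Fin 2) (Fin 2) ℝ).det = 1 := by
    rw [Matrix.det_fin_two_of]; nlinarith [h]
  simp [hd]

end BlockTriangular

/-! ## §2. An `ad`-invariant linear functional on a perfect Lie algebra vanishes -/

section Perfect

variable {R L : Type*} [CommRing R] [LieRing L] [LieAlgebra R L]

/-- If a linear functional kills every bracket and the Lie algebra is perfect (`⁅⊤, ⊤⁆ = ⊤`), the functional is
zero.  AN2.md §8.10 (c) STEP 1: the first variation at the unit configuration of a gauge- and `Ad`-invariant
level-local functional is such a functional on (a product of copies of) `su(N)`. [folklore] -/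
theorem eq_zero_of_forall_lie_of_perfect (f : L →ₗ[R] R) (hf : ∀ x y : L, f ⁅x, y⁆ = 0)
    (hperf : (⁅(⊤ : LieIdeal R L), (⊤ : LieIdeal R L)⁆ : LieIdeal R L) = ⊤) : f = 0 := by
  have hle : Submodule.span R {m : L | ∃ (x : (⊤ : LieIdeal R L)) (n : (⊤ : LieIdeal R L)), ⁅(x : L), (n : L)⁆ = m}
      ≤ LinearMap.ker f := by
    rw [Submodule.span_le]
    rintro m ⟨x, n, rfl⟩
    exact hf x n
  have key : LieSubmodule.toSubmodule (⁅(⊤ : LieIdeal R L), (⊤ : LieIdeal R L)⁆ : LieSubmodule R L L)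
      ≤ LinearMap.ker f := by
    rw [LieSubmodule.lieIdeal_oper_eq_linear_span]; exact hle
  ext x
  have hx' : x ∈ (⁅(⊤ : LieIdeal R L), (⊤ : LieIdeal R L)⁆ : LieIdeal R L) := by
    rw [hperf]; exact LieSubmodule.mem_top x
  have hx : x ∈ LinearMap.ker f := key hx'
  simpa using hx

/-- Pointwise form. [folklore] -/
theorem apply_eq_zero_of_forall_lie_of_perfect (f : L →ₗ[R] R) (hf : ∀ x y : L, f ⁅x, y⁆ = 0)
    (hperf : (⁅(⊤ : LieIdeal R L), (⊤ : LieIdeal R L)⁆ : LieIdeal R L) = ⊤) (x : L) : f x = 0 := by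
  rw [eq_zero_of_forall_lie_of_perfect f hf hperf, LinearMap.zero_apply]

/-- The hypothesis `hf` in invariant form: `f ∘ ad x = 0` for all `x`. [folklore] -/
theorem eq_zero_of_comp_ad_eq_zero_of_perfect (f : L →ₗ[R] R)
    (hf : ∀ x : L, f ∘ₗ (LieAlgebra.ad R L x : L →ₗ[R] L) = 0)
    (hperf : (⁅(⊤ : LieIdeal R L), (⊤ : LieIdeal R L)⁆ : LieIdeal R L) = ⊤) : f = 0 :=
  eq_zero_of_forall_lie_of_perfect f (fun x y => by
    have := LinearMap.congr_fun (hf x) y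
    simpa using this) hperf

/-- A SIMPLE Lie algebra (Mathlib's `LieAlgebra.IsSimple`: every ideal is `⊥` or `⊤`, and non-abelian) is perfect.
[folklore] -/
theorem lie_top_self_eq_top_of_isSimple [LieAlgebra.IsSimple R L] :
    (⁅(⊤ : LieIdeal R L), (⊤ : LieIdeal R L)⁆ : LieIdeal R L) = ⊤ := by
  rcases LieAlgebra.IsSimple.eq_bot_or_eq_top (⁅(⊤ : LieIdeal R L), (⊤ : LieIdeal R L)⁆ : LieIdeal R L)
    with h | h
  · exfalso
    apply LieAlgebra.IsSimple.non_abelian (R := R) (L := L)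
    rw [LieSubmodule.lie_eq_bot_iff] at h
    exact ⟨fun x y => h x (LieSubmodule.mem_top x) y (LieSubmodule.mem_top y)⟩
  · exact h

/-- Hence on a simple Lie algebra an `ad`-invariant linear functional vanishes (the form used for each `su(N)`
factor of the gauge algebra, `N ≥ 2` — the simplicity of `su(N)` itself is not in Mathlib and stays a dictionary
sentence). [folklore] -/
theorem eq_zero_of_forall_lie_of_isSimple [LieAlgebra.IsSimple R L] (f : L →ₗ[R] R)
    (hf : ∀ x y : L, f ⁅x, y⁆ = 0) : f = 0 :=
  eq_zero_of_forall_lie_of_perfect f hf lie_top_self_eq_top_of_isSimple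

end Perfect

end Literature.MathematicalPhysics.QuantumFieldTheory.Balaban1983to89.Beta.LocalJacobianAlgebra
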